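import Summits.RiemannHypothesis.RiemannHypothesis.Theorems.JensenPolynomialsFarGumbelDefs
import Summits.RiemannHypothesis.RiemannHypothesis.Theorems.JensenPolynomialsFarProfileH1
import HarnessLib

/-!
# Route `JensenPolynomials`, crux `XiWindowZeroFreeRelFar`, stub `stub_elementary` (far-Gumbel line, S4) — layer (b):
the second-order remainder of the Gumbel phase at the approximate saddle,
`‖f(ξ₀; w, ε) + 1 − (H₀(w) + 1) − εH₁(w)‖ ≤ ε²/2` on `‖z̃‖ ≤ 0.3502`, `0 < ε ≤ 20/189`
(RH-FREE; cell rh-jensen, HUMAN RULING D-0040 / D-0074)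

LINE 1 (D-0074 framing): elementary complex analysis (one algebraic identity + termwise norm bounds); nothing here bears on the
zeros of `ζ` or is progress toward RH.

Objects of `JensenPolynomialsFarGumbelDefs` (theory g8's far-Gumbel line v3): `farW z = (1+z)⁻¹ = w`,
`farF w ε ξ = (2/ε)Log(1 + w(εξ/2 + ε²ξ²/16)) − e^ξ`, `farXi0 w ε = Log w·(1 + ε(1/4 − w/2)) = ξ₀`. With `L = Log(1+z)`
(so `Log w = −L`), `a = 1/4 − w/2`, `t = −εaL` (`e^{ξ₀} = w·e^{t}`), `X̃ = w(ξ₀/2 + εξ₀²/16)` (the `Log`-argument is `1 + εX̃`),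
`H₀ + 1 = (z − L)w`, `H₁ = L²(w/8 − w²/4)` — the EXACT IDENTITY (rh-jensen-eng-6 g3, HOME `eng6/s4-elementary/README.md`)

  `f(ξ₀)+1 − (H₀+1) − εH₁ = ε²{H₁(2a + εa²) − w²ξ₀³/16 − εw²ξ₀⁴/256} − w(e^{t} − 1 − t) + (2/ε)·[Log(1+εX̃) − εX̃ + ε²X̃²/2]`

(`farGumbel_alg_identity`, `farF_farXi0_eq`) and the termwise bounds `‖w‖ ≤ 5000/3249`, `‖L‖ ≤ 3R/2`, `‖a‖ ≤ 13/25`, `‖ξ₀‖ ≤ 5/9`,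
`‖X̃‖ ≤ 11/25`, `‖t‖ ≤ (7/25)ε`, `‖e^t − 1 − t‖ ≤ ‖t‖²` (Mathlib `Complex.norm_exp_sub_one_sub_id_le`),
`‖Log(1+y) − y + y²/2‖ ≤ ‖y‖³/(3(1−‖y‖))` (Mathlib `Complex.norm_log_sub_logTaylor_le`), `‖H₁‖ ≤ 11/50` (`norm_farH1_le`) give

* `norm_farF_farXi0_sub_le`: `‖farF (farW z) ε (farXi0 (farW z) ε) + 1 − (z − Log(1+z))/(1+z) − ε·Log(1+z)²((1+z)⁻¹/8 − (1+z)⁻²/4)‖ ≤ ε²/2`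
  (true constant `0.0505`; crude termwise total `0.435`).

Together with the certified constants `c₀ ≤ 47/10000`, `c₁ ≤ 11/400`, `c₂ ≤ 29/1000` (files `JensenPolynomialsFarProfile{Log,H0,H1}`):
`c₀ + (ε/2)c₁ + (ε²/2)c₂ + (ε³/2)·(1/2) ≤ 0.00662 < 1/150` at `ε = 20/189` — the profile budget of `stub_elementary` (ii).

WHAT THIS IS NOT: nothing about `ξ` or `ζ`. References: theory g8 line card `line-far-gumbel.md` (item evidence on 19465);
Titchmarsh, *Theory of Functions* (1939) §5.1 [Titchmarsh1939].
-/

noncomputable section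

open Complex Set Metric

-- D-0017: `Summit.RiemannHypothesis.RiemannHypothesis.…` duplicates the namespace BY DESIGN (single-problem summit).
set_option linter.dupNamespace false

namespace Summit.RiemannHypothesis.RiemannHypothesis.Theorems.JensenPolynomials.CoeffTable

open Summit.RiemannHypothesis.RiemannHypothesis.Theorems.JensenPolynomials.FarGumbel

/-! ## 1. The identity -/

/-- **The algebraic identity** behind layer (b): for abstract `z w L a ξ₀ t X E G : ℂ` with `w(1+z) = 1`, `a = 1/4 − w/2`,
`ξ₀ = −L(1 + εa)`, `t = −εaL`, `X = w(ξ₀/2 + εξ₀²/16)`, `ε ≠ 0` (`E` stands for `e^{t}`, `G` for `Log(1 + εX)`):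
`(2/ε)G − wE + 1 − (z − L)w − εL²(w/8 − w²/4) = ε²{L²(w/8 − w²/4)(2a + εa²) − w²ξ₀³/16 − εw²ξ₀⁴/256} − w(E − 1 − t)
 + (2/ε)(G − εX + (εX)²/2)`. -/
theorem farGumbel_alg_identity (z w L a ξ₀ t X E G : ℂ) (ε : ℝ) (hε : ε ≠ 0) (hw : w * (1 + z) = 1)
    (ha : a = 1 / 4 - w / 2) (hξ : ξ₀ = -L * (1 + (ε : ℂ) * a)) (ht : t = -(ε : ℂ) * a * L)
    (hX : X = w * (ξ₀ / 2 + (ε : ℂ) * ξ₀ ^ 2 / 16)) :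
    ((2 / ε : ℝ) : ℂ) * G - w * E + 1 - (z - L) * w - (ε : ℂ) * (L ^ 2 * (w / 8 - w ^ 2 / 4)) =
      (ε : ℂ) ^ 2 * ((L ^ 2 * (w / 8 - w ^ 2 / 4)) * (2 * a + (ε : ℂ) * a ^ 2) - w ^ 2 * ξ₀ ^ 3 / 16 -
          (ε : ℂ) * w ^ 2 * ξ₀ ^ 4 / 256) -
        w * (E - 1 - t) + ((2 / ε : ℝ) : ℂ) * (G - ((ε : ℂ) * X - ((ε : ℂ) * X) ^ 2 / 2)) := by
  have hε' : (ε : ℂ) ≠ 0 := by exact_mod_cast hε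
  subst ha ht hX
  subst hξ
  have hzw : (z - L) * w = 1 - w - L * w := by linear_combination hw
  rw [hzw]
  push_cast
  field_simp
  ring

/-- **`farF (farW z) ε (farXi0 (farW z) ε)` in closed pieces**: with `L = Log(1+z)`, `w = (1+z)⁻¹`, `a = 1/4 − w/2`,
`ξ₀ = −L(1+εa)`, `t = −εaL`, `X̃ = w(ξ₀/2 + εξ₀²/16)`: `farXi0 (farW z) ε = ξ₀`, `e^{ξ₀} = w·e^{t}`, and the `Log`-argument
is `1 + εX̃` (`‖z‖ < 1`). -/
theorem farF_farXi0_eq {z : ℂ} (hz : ‖z‖ < 1) (ε : ℝ) :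
    farXi0 (farW z) ε = -Complex.log (1 + z) * (1 + (ε : ℂ) * (1 / 4 - (1 + z)⁻¹ / 2)) ∧
    Complex.exp (-Complex.log (1 + z) * (1 + (ε : ℂ) * (1 / 4 - (1 + z)⁻¹ / 2))) =
      (1 + z)⁻¹ * Complex.exp (-(ε : ℂ) * (1 / 4 - (1 + z)⁻¹ / 2) * Complex.log (1 + z)) ∧
    farF (farW z) ε (farXi0 (farW z) ε) =
      ((2 / ε : ℝ) : ℂ) * Complex.log (1 + (ε : ℂ) * ((1 + z)⁻¹ *
          (farXi0 (farW z) ε / 2 + (ε : ℂ) * farXi0 (farW z) ε ^ 2 / 16))) -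
        Complex.exp (farXi0 (farW z) ε) := by
  have hslit : 1 + z ∈ Complex.slitPlane := Complex.mem_slitPlane_of_norm_lt_one hz
  have h1z : 1 + z ≠ 0 := Complex.slitPlane_ne_zero hslit
  have hLw : Complex.log (1 + z)⁻¹ = -Complex.log (1 + z) := Complex.log_inv _ (Complex.slitPlane_arg_ne_pi hslit)
  refine ⟨?_, ?_, ?_⟩
  · show Complex.log (1 + z)⁻¹ * (1 + (ε : ℂ) * (1 / 4 - (1 + z)⁻¹ / 2)) = _
    rw [hLw]
  · have e1 : -Complex.log (1 + z) * (1 + (ε : ℂ) * (1 / 4 - (1 + z)⁻¹ / 2)) =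
        -Complex.log (1 + z) + -(ε : ℂ) * (1 / 4 - (1 + z)⁻¹ / 2) * Complex.log (1 + z) := by ring
    rw [e1, Complex.exp_add, Complex.exp_neg, Complex.exp_log h1z]
  · show ((2 / ε : ℝ) : ℂ) * Complex.log (1 + (1 + z)⁻¹ * ((ε : ℂ) * farXi0 (farW z) ε / 2 +
        (ε : ℂ) ^ 2 * farXi0 (farW z) ε ^ 2 / 16)) - Complex.exp (farXi0 (farW z) ε) = _
    congr 3
    ring

/-! ## 2. The termwise bounds and the remainder estimate -/

/-- `logTaylor 3 y = y − y²/2`. -/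
theorem logTaylor_three (y : ℂ) : Complex.logTaylor 3 y = y - y ^ 2 / 2 := by
  simp only [Complex.logTaylor, Finset.sum_range_succ, Finset.sum_range_zero]
  push_cast
  ring

/-- **Layer (b) of `stub_elementary`**: for `‖z‖ ≤ 3502/10000` and `0 < ε ≤ 20/189`,
`‖farF (farW z) ε (farXi0 (farW z) ε) + 1 − (z − Log(1+z))/(1+z) − ε·Log(1+z)²((1+z)⁻¹/8 − (1+z)⁻²/4)‖ ≤ ε²/2`. -/
theorem norm_farF_farXi0_sub_le {z : ℂ} (hz : ‖z‖ ≤ (3502 / 10000 : ℝ)) {ε : ℝ} (hε0 : 0 < ε)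
    (hε : ε ≤ 20 / 189) :
    ‖farF (farW z) ε (farXi0 (farW z) ε) + 1 - (z - Complex.log (1 + z)) / (1 + z) -
        (ε : ℂ) * (Complex.log (1 + z) ^ 2 * ((1 + z)⁻¹ / 8 - (1 + z)⁻¹ ^ 2 / 4))‖ ≤ ε ^ 2 / 2 := by
  have hz1 : ‖z‖ < 1 := lt_of_le_of_lt hz (by norm_num)
  have hz2 : ‖z‖ ≤ 1 / 2 := hz.trans (by norm_num)
  obtain ⟨h1z0, hW⟩ := norm_inv_one_add_le hz
  have hε1 : ε ≤ 1 := hε.trans (by norm_num)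
  -- names
  set L := Complex.log (1 + z) with hL
  set w := (1 + z)⁻¹ with hw
  set a : ℂ := 1 / 4 - w / 2 with ha
  set ξ₀ : ℂ := -L * (1 + (ε : ℂ) * a) with hξ
  set t : ℂ := -(ε : ℂ) * a * L with ht
  set X : ℂ := w * (ξ₀ / 2 + (ε : ℂ) * ξ₀ ^ 2 / 16) with hX
  set E := Complex.exp t with hE
  set G := Complex.log (1 + (ε : ℂ) * X) with hG
  -- rewrite `farF (farW z) ε (farXi0 (farW z) ε)` as `(2/ε)G − wE`
  obtain ⟨hxi, hexp, hF⟩ := farF_farXi0_eq hz1 ε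
  have hxi' : farXi0 (farW z) ε = ξ₀ := by rw [hxi]
  have hFF : farF (farW z) ε (farXi0 (farW z) ε) = ((2 / ε : ℝ) : ℂ) * G - w * E := by
    rw [hF, hxi', hG, hX, hE, hξ, hexp, ht]
  have hw1 : w * (1 + z) = 1 := inv_mul_cancel₀ h1z0
  have hdiv : (z - L) / (1 + z) = (z - L) * w := div_eq_mul_inv _ _
  rw [hFF, hdiv, farGumbel_alg_identity z w L a ξ₀ t X E G ε hε0.ne' hw1 ha hξ ht hX]
  -- the sizes
  have hLn : ‖L‖ ≤ 5253 / 10000 := by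
    have := Complex.norm_log_one_add_half_le_self hz2; rw [← hL] at this; nlinarith [norm_nonneg z]
  have hH1 : ‖L ^ 2 * (w / 8 - w ^ 2 / 4)‖ ≤ 11 / 50 := by
    have := norm_farH1_le hz; rw [← hL, ← hw] at this; exact this
  have hae : a = (z - 1) * w / 4 := by
    rw [ha]; linear_combination (-(1 : ℂ) / 4) * hw1
  clear_value G E X t ξ₀ a w L
  have han : ‖a‖ ≤ 13 / 25 := by
    rw [hae, norm_div, norm_mul]
    have : ‖z - 1‖ ≤ 3502 / 10000 + 1 := (norm_sub_le z 1).trans (by rw [norm_one]; linarith)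
    have h4 : ‖(4 : ℂ)‖ = 4 := by simp
    rw [h4, div_le_iff₀ (by norm_num : (0:ℝ) < 4)]
    calc ‖z - 1‖ * ‖w‖ ≤ (3502 / 10000 + 1) * (5000 / 3249) := mul_le_mul this hW (norm_nonneg _) (by norm_num)
      _ ≤ 13 / 25 * 4 := by norm_num
  have hεn : ‖(ε : ℂ)‖ = ε := by rw [Complex.norm_real, Real.norm_of_nonneg hε0.le]
  have hξn : ‖ξ₀‖ ≤ 5 / 9 := by
    rw [hξ, norm_mul, norm_neg]
    have h1 : ‖1 + (ε : ℂ) * a‖ ≤ 1 + 20 / 189 * (13 / 25) := by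
      calc ‖1 + (ε : ℂ) * a‖ ≤ ‖(1 : ℂ)‖ + ‖(ε : ℂ) * a‖ := norm_add_le _ _
        _ ≤ 1 + 20 / 189 * (13 / 25) := by
          rw [norm_one, norm_mul, hεn]; gcongr
    calc ‖L‖ * ‖1 + (ε : ℂ) * a‖ ≤ 5253 / 10000 * (1 + 20 / 189 * (13 / 25)) :=
          mul_le_mul hLn h1 (norm_nonneg _) (by norm_num)
      _ ≤ 5 / 9 := by norm_num
  have htn : ‖t‖ ≤ 7 / 25 * ε := by
    rw [ht, norm_mul, norm_mul, norm_neg, hεn]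
    calc ε * ‖a‖ * ‖L‖ ≤ ε * (13 / 25) * (5253 / 10000) := by gcongr
      _ ≤ 7 / 25 * ε := by nlinarith
  have ht1 : ‖t‖ ≤ 1 := htn.trans (by nlinarith)
  have hXn : ‖X‖ ≤ 11 / 25 := by
    rw [hX, norm_mul]
    have e1 : ‖ξ₀ / 2‖ = ‖ξ₀‖ / 2 := by rw [norm_div]; simp
    have e2 : ‖(ε : ℂ) * ξ₀ ^ 2 / 16‖ = ε * ‖ξ₀‖ ^ 2 / 16 := by rw [norm_div, norm_mul, norm_pow, hεn]; simp
    have h1 : ‖ξ₀ / 2 + (ε : ℂ) * ξ₀ ^ 2 / 16‖ ≤ 5 / 9 / 2 + 20 / 189 * (5 / 9) ^ 2 / 16 := by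
      calc ‖ξ₀ / 2 + (ε : ℂ) * ξ₀ ^ 2 / 16‖ ≤ ‖ξ₀ / 2‖ + ‖(ε : ℂ) * ξ₀ ^ 2 / 16‖ := norm_add_le _ _
        _ = ‖ξ₀‖ / 2 + ε * ‖ξ₀‖ ^ 2 / 16 := by rw [e1, e2]
        _ ≤ 5 / 9 / 2 + 20 / 189 * (5 / 9) ^ 2 / 16 := by
          have hp : ‖ξ₀‖ ^ 2 ≤ (5 / 9) ^ 2 := pow_le_pow_left₀ (norm_nonneg _) hξn 2
          nlinarith [norm_nonneg ξ₀, mul_le_mul hε hp (by positivity) (by norm_num)]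
    calc ‖w‖ * ‖ξ₀ / 2 + (ε : ℂ) * ξ₀ ^ 2 / 16‖ ≤ 5000 / 3249 * (5 / 9 / 2 + 20 / 189 * (5 / 9) ^ 2 / 16) :=
          mul_le_mul hW h1 (norm_nonneg _) (by norm_num)
      _ ≤ 11 / 25 := by norm_num
  have hyn : ‖(ε : ℂ) * X‖ ≤ ε * (11 / 25) := by rw [norm_mul, hεn]; gcongr
  have hy1 : ‖(ε : ℂ) * X‖ < 1 := lt_of_le_of_lt hyn (by nlinarith)
  -- the three pieces
  have hA : ‖(ε : ℂ) ^ 2 * ((L ^ 2 * (w / 8 - w ^ 2 / 4)) * (2 * a + (ε : ℂ) * a ^ 2) - w ^ 2 * ξ₀ ^ 3 / 16 -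
      (ε : ℂ) * w ^ 2 * ξ₀ ^ 4 / 256)‖ ≤ ε ^ 2 * (261 / 1000) := by
    rw [norm_mul, norm_pow, hεn]
    refine mul_le_mul_of_nonneg_left ?_ (by positivity)
    have h2a : ‖2 * a + (ε : ℂ) * a ^ 2‖ ≤ 2 * (13 / 25) + 20 / 189 * (13 / 25) ^ 2 := by
      calc ‖2 * a + (ε : ℂ) * a ^ 2‖ ≤ ‖2 * a‖ + ‖(ε : ℂ) * a ^ 2‖ := norm_add_le _ _
        _ ≤ 2 * (13 / 25) + 20 / 189 * (13 / 25) ^ 2 := by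
          rw [norm_mul, norm_mul, norm_pow, hεn]; simp only [RCLike.norm_ofNat]
          gcongr
    have p1 : ‖(L ^ 2 * (w / 8 - w ^ 2 / 4)) * (2 * a + (ε : ℂ) * a ^ 2)‖ ≤
        11 / 50 * (2 * (13 / 25) + 20 / 189 * (13 / 25) ^ 2) := by
      rw [norm_mul]; exact mul_le_mul hH1 h2a (norm_nonneg _) (by norm_num)
    have p2 : ‖w ^ 2 * ξ₀ ^ 3 / 16‖ ≤ (5000 / 3249) ^ 2 * (5 / 9) ^ 3 / 16 := by
      rw [norm_div, norm_mul, norm_pow, norm_pow]; simp only [RCLike.norm_ofNat]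
      gcongr
    have p3 : ‖(ε : ℂ) * w ^ 2 * ξ₀ ^ 4 / 256‖ ≤ 20 / 189 * (5000 / 3249) ^ 2 * (5 / 9) ^ 4 / 256 := by
      rw [norm_div, norm_mul, norm_mul, norm_pow, norm_pow, hεn]; simp only [RCLike.norm_ofNat]
      gcongr
    calc _ ≤ ‖(L ^ 2 * (w / 8 - w ^ 2 / 4)) * (2 * a + (ε : ℂ) * a ^ 2) - w ^ 2 * ξ₀ ^ 3 / 16‖ +
          ‖(ε : ℂ) * w ^ 2 * ξ₀ ^ 4 / 256‖ := norm_sub_le _ _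
      _ ≤ (‖(L ^ 2 * (w / 8 - w ^ 2 / 4)) * (2 * a + (ε : ℂ) * a ^ 2)‖ + ‖w ^ 2 * ξ₀ ^ 3 / 16‖) +
          ‖(ε : ℂ) * w ^ 2 * ξ₀ ^ 4 / 256‖ := by gcongr; exact norm_sub_le _ _
      _ ≤ 11 / 50 * (2 * (13 / 25) + 20 / 189 * (13 / 25) ^ 2) + (5000 / 3249) ^ 2 * (5 / 9) ^ 3 / 16 +
          20 / 189 * (5000 / 3249) ^ 2 * (5 / 9) ^ 4 / 256 := by linarith
      _ ≤ 261 / 1000 := by norm_num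
  have hB : ‖w * (E - 1 - t)‖ ≤ ε ^ 2 * (121 / 1000) := by
    rw [norm_mul]
    have hexp2 : ‖E - 1 - t‖ ≤ ‖t‖ ^ 2 := by rw [hE]; exact Complex.norm_exp_sub_one_sub_id_le ht1
    have ht2 : ‖t‖ ^ 2 ≤ (7 / 25 * ε) ^ 2 := pow_le_pow_left₀ (norm_nonneg _) htn 2
    calc ‖w‖ * ‖E - 1 - t‖ ≤ 5000 / 3249 * (7 / 25 * ε) ^ 2 :=
          mul_le_mul hW (hexp2.trans ht2) (norm_nonneg _) (by norm_num)
      _ ≤ ε ^ 2 * (121 / 1000) := by nlinarith [sq_nonneg ε]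
  have hC : ‖((2 / ε : ℝ) : ℂ) * (G - ((ε : ℂ) * X - ((ε : ℂ) * X) ^ 2 / 2))‖ ≤ ε ^ 2 * (6 / 100) := by
    have hrem := Complex.norm_log_sub_logTaylor_le 2 hy1
    rw [logTaylor_three] at hrem
    rw [norm_mul, Complex.norm_real, Real.norm_of_nonneg (by positivity : (0:ℝ) ≤ 2 / ε), hG]
    -- `‖εX‖³(1 − ‖εX‖)⁻¹/3 ≤ (ε·11/25)³·(1 − 20/189·11/25)⁻¹/3`
    have hq : ‖(ε : ℂ) * X‖ ≤ 20 / 189 * (11 / 25) := hyn.trans (by nlinarith)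
    have hinv : (1 - ‖(ε : ℂ) * X‖)⁻¹ ≤ (1 - 20 / 189 * (11 / 25) : ℝ)⁻¹ :=
      inv_anti₀ (by norm_num) (by linarith)
    have hcube : ‖(ε : ℂ) * X‖ ^ (2 + 1) ≤ (ε * (11 / 25)) ^ 3 := pow_le_pow_left₀ (norm_nonneg _) hyn 3
    have h3 : ‖Complex.log (1 + (ε : ℂ) * X) - ((ε : ℂ) * X - ((ε : ℂ) * X) ^ 2 / 2)‖ ≤
        (ε * (11 / 25)) ^ 3 * (1 - 20 / 189 * (11 / 25) : ℝ)⁻¹ / (2 + 1) := by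
      refine hrem.trans ?_
      have hnum : ‖(ε : ℂ) * X‖ ^ (2 + 1) * (1 - ‖(ε : ℂ) * X‖)⁻¹ ≤
          (ε * (11 / 25)) ^ 3 * (1 - 20 / 189 * (11 / 25) : ℝ)⁻¹ :=
        mul_le_mul hcube hinv (inv_nonneg.2 (by linarith)) (by positivity)
      have hd : ((2 : ℕ) : ℝ) + 1 = (2 + 1 : ℝ) := by norm_num
      rw [hd]
      exact div_le_div_of_nonneg_right hnum (by norm_num)
    calc 2 / ε * ‖Complex.log (1 + (ε : ℂ) * X) - ((ε : ℂ) * X - ((ε : ℂ) * X) ^ 2 / 2)‖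
        ≤ 2 / ε * ((ε * (11 / 25)) ^ 3 * (1 - 20 / 189 * (11 / 25) : ℝ)⁻¹ / (2 + 1)) :=
          mul_le_mul_of_nonneg_left h3 (by positivity)
      _ = ε ^ 2 * (2 * (11 / 25) ^ 3 * (1 - 20 / 189 * (11 / 25) : ℝ)⁻¹ / 3) := by
          field_simp; ring
      _ ≤ ε ^ 2 * (6 / 100) := by
          refine mul_le_mul_of_nonneg_left ?_ (by positivity); norm_num
  calc _ ≤ ‖(ε : ℂ) ^ 2 * ((L ^ 2 * (w / 8 - w ^ 2 / 4)) * (2 * a + (ε : ℂ) * a ^ 2) - w ^ 2 * ξ₀ ^ 3 / 16 -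
            (ε : ℂ) * w ^ 2 * ξ₀ ^ 4 / 256) - w * (E - 1 - t)‖ +
          ‖((2 / ε : ℝ) : ℂ) * (G - ((ε : ℂ) * X - ((ε : ℂ) * X) ^ 2 / 2))‖ := norm_add_le _ _
    _ ≤ (ε ^ 2 * (261 / 1000) + ε ^ 2 * (121 / 1000)) + ε ^ 2 * (6 / 100) := by
        gcongr; exact (norm_sub_le _ _).trans (add_le_add hA hB)
    _ ≤ ε ^ 2 / 2 := by nlinarith [sq_nonneg ε]

end Summit.RiemannHypothesis.RiemannHypothesis.Theorems.JensenPolynomials.CoeffTable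

end
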